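import Summits.BirchSwinnertonDyer.BirchSwinnertonDyer.Theorems.GenusKolyvaginAtTwoGenusPrimitiveSupplyAtTwoHeegnerTwinTamagawa
import Literature.NumberTheory.QuadraticFields.FundamentalDiscriminant
import Mathlib.Algebra.QuadraticDiscriminant
import HarnessLib

/-!
# Route `GenusKolyvaginAtTwo`, crux `GenusPrimitiveSupplyAtTwo` (stmt-BirchSwinnertonDyer-22136):
# transposition primes in root-count currency — `ψ` has exactly one root mod `q` iff `(Δ_min / q) = −1`

Seat `bsd-line-gk2-p5` g2 (cell `bsd-f1-sign2`), SUPPLY lineage; fourth file of the Heegner-twin series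
(`…HeegnerTwinParity.lean`, `…HeegnerTwinTamagawa.lean`, `…HeegnerTwinTamagawaOdd.lean`). Summit-side THEOREM-ONLY file
(no definition, no named fact, no `sorry`), `--supports stmt-BirchSwinnertonDyer-22136`, route-independent imports.

WHAT.
* §12 (any field `k`, cubic `P`, `a ≠ 0`): `splits_of_two_roots`, `isSquare_discr_of_splits`,
  `eq_of_isRoot_of_not_isSquare_discr` (non-square discriminant ⇒ at most one root), `not_isSquare_discr_of_existsUnique_isRoot`
  (`2 ≠ 0`, `disc ≠ 0`: exactly one root ⇒ non-square discriminant, via `disc P = P'(r)²·disc(P/(X−r))` and the quadratic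
  formula), and — over a FINITE field of odd characteristic — **`existsUnique_isRoot_iff_not_isSquare_discr`** (Stickelberger's
  parity theorem for cubics: exactly one root ⟺ `disc` non-square; existence from `exists_isRoot_of_not_isSquare_discr`).
* §13 **`existsUnique_zmod_root_twoTorsion_iff_jacobiSym_eq_neg_one`**: for `W/ℚ` globally minimal and a prime
  `q ∤ 2Δ_min(W)`, the `2`-division cubic `ψ = 4x³ + b₂x² + 2b₄x + b₆` of the minimal model has EXACTLY ONE root mod `q`
  iff `(Δ_min(W) / q) = −1` — the «transposition primes» of the cell bus in the pen's currency («number of roots of the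
  2-division polynomial over ZMod q», gk2-p2 g4 note #4 (4)).
* §14 **`odd_card_transpositionPrimes_iff_Δ_neg`**: for `K` imaginary quadratic with ODD `d_K` and the Heegner hypothesis
  for `N_W`, the number of primes `q ∣ d_K` at which `ψ` has exactly one root is ODD iff `Δ_W < 0` (`|d_K|` squarefree,
  `(Δ_min | |d_K|) = ∏_q (Δ_min / q) = sign Δ_min` by the first file).

WHY (planner-facing). The typed DEF-clause of the repair census (gk2-p1 g3 REPAIR CENSUS v1.2 §6: «DEF(W,K) = 1» mandatory
in the child items; gk2-p2 g4 C⁗) counts, for `q ∣ d_K`, `dim Ẽ(𝔽_q)[2] ∈ {0,1,2}` ⟷ `#roots of ψ mod q ∈ {0,1,3}`. This file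
pins the parity of that count: `DEF(E,K) ≡ #{q ∣ d_K : exactly one root} + [Δ_E > 0] ≡ 1 (mod 2)` — so «DEF = 1» reads: for
`Δ_E < 0` exactly one transposition prime and no prime with three roots, for `Δ_E > 0` no transposition prime and no prime
with three roots (all silent; = the odd-Tamagawa twins of `odd_tamagawaProduct_twin_iff`). No item is closed; BSD is not
proved by any of this.

References: [SilvermanAEC2009] III.1 (ψ₂, `disc ψ₂ = 16Δ`), VIII.8; [IrelandRosen1990] Prop. 5.2.2 (Jacobi reciprocity).
-/
set_option linter.dupNamespace false -- tree convention: `Summit.BirchSwinnertonDyer.BirchSwinnertonDyer.Theorems` (summit = sub-problem)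
set_option autoImplicit false

open NumberField

namespace Summit.BirchSwinnertonDyer.BirchSwinnertonDyer.Theorems.GenusKolyTwin

/-! ## §12. Cubics over a field: exactly one root iff the discriminant is a non-square (Stickelberger for cubics) -/

section Cubic

open Polynomial

variable {k : Type*} [Field k]

/-- A cubic with two distinct roots in `k` splits over `k` (divide out one root; the quadratic cofactor has a root).
[folklore] -/
theorem splits_of_two_roots (P : Cubic k) (ha : P.a ≠ 0) {t₁ t₂ : k} (h₁ : P.toPoly.IsRoot t₁)
    (h₂ : P.toPoly.IsRoot t₂) (hne : t₁ ≠ t₂) : P.toPoly.Splits := by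
  have hf : (X - C t₁) * (P.toPoly /ₘ (X - C t₁)) = P.toPoly := mul_divByMonic_eq_iff_isRoot.mpr h₁
  set g := P.toPoly /ₘ (X - C t₁) with hg
  have hdeg : P.toPoly.natDegree = 3 := Cubic.natDegree_of_a_ne_zero ha
  have hg0 : g ≠ 0 := by
    intro h0
    rw [h0, mul_zero] at hf
    exact Cubic.ne_zero_of_a_ne_zero ha hf.symm
  have hgdeg : g.natDegree = 2 := by
    have h := congr_arg natDegree hf
    rw [natDegree_mul (X_sub_C_ne_zero t₁) hg0, natDegree_X_sub_C, hdeg] at h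
    omega
  have hg₂ : g.eval t₂ = 0 := by
    have h := h₂.eq_zero
    rw [← hf, eval_mul, eval_sub, eval_X, eval_C] at h
    exact (mul_eq_zero.mp h).resolve_left (sub_ne_zero.mpr hne.symm)
  rw [← hf, splits_X_sub_C_mul_iff]
  exact Splits.of_natDegree_eq_two hgdeg hg₂

/-- A cubic that splits over `k` has square discriminant (`disc = (a²(x−y)(x−z)(y−z))²`). [folklore] -/
theorem isSquare_discr_of_splits (P : Cubic k) (ha : P.a ≠ 0) (hs : P.toPoly.Splits) : IsSquare P.discr := by
  have hs' : (P.toPoly.map (RingHom.id k)).Splits := by rwa [Polynomial.map_id]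
  obtain ⟨x, y, z, h3⟩ := (Cubic.splits_iff_roots_eq_three ha).mp hs'
  have h := Cubic.discr_eq_prod_three_roots ha h3
  rw [RingHom.id_apply] at h
  exact ⟨_, by rw [h, sq]⟩

/-- **Non-square discriminant ⇒ at most one root.** [folklore] -/
theorem eq_of_isRoot_of_not_isSquare_discr (P : Cubic k) (ha : P.a ≠ 0) (hdisc : ¬ IsSquare P.discr) {t₁ t₂ : k}
    (h₁ : P.toPoly.IsRoot t₁) (h₂ : P.toPoly.IsRoot t₂) : t₁ = t₂ := by
  by_contra hne
  exact hdisc (isSquare_discr_of_splits P ha (splits_of_two_roots P ha h₁ h₂ hne))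

/-- **Non-square discriminant ⇒ exactly one root** (finite field of odd characteristic; existence by
`exists_isRoot_of_not_isSquare_discr`). [folklore] -/
theorem existsUnique_isRoot_of_not_isSquare_discr [Fintype k] (h2 : ringChar k ≠ 2) (P : Cubic k) (ha : P.a ≠ 0)
    (hdisc : ¬ IsSquare P.discr) : ∃! t : k, P.toPoly.IsRoot t := by
  obtain ⟨t, ht⟩ := exists_isRoot_of_not_isSquare_discr h2 P ha hdisc
  exact ⟨t, ht, fun s hs => eq_of_isRoot_of_not_isSquare_discr P ha hdisc hs ht⟩

/-- **Exactly one root ⇒ non-square discriminant** (any field with `2 ≠ 0`, `disc ≠ 0`). With the root `r`,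
`P = (X − r)·g`, `g = aX² + (b + ar)X + (c + br + ar²)`, `g(r) = P'(r) ≠ 0` and `disc P = g(r)²·disc g`; a square `disc P`
makes `disc g` a square, so `g` has a root — a second root of `P`. [folklore] -/
theorem not_isSquare_discr_of_existsUnique_isRoot [NeZero (2 : k)] (P : Cubic k) (ha : P.a ≠ 0) (hdisc0 : P.discr ≠ 0)
    (hu : ∃! t : k, P.toPoly.IsRoot t) : ¬ IsSquare P.discr := by
  obtain ⟨r, hr, huniq⟩ := hu
  have hr0 : P.a * r ^ 3 + P.b * r ^ 2 + P.c * r + P.d = 0 := by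
    have h := hr.eq_zero
    simp only [Cubic.toPoly, eval_add, eval_mul, eval_C, eval_pow, eval_X] at h
    linear_combination h
  -- the simple-root condition `g(r) = P'(r) ≠ 0`
  have hgr : 3 * P.a * r ^ 2 + 2 * P.b * r + P.c ≠ 0 := by
    intro h0
    apply eval_derivative_ne_zero_of_discr_ne_zero P ha hdisc0 hr
    simp only [Cubic.toPoly, derivative_add, derivative_mul, derivative_C, derivative_X_pow, derivative_X, eval_add,
      eval_mul, eval_C, eval_pow, eval_X, zero_mul, add_zero, zero_add, mul_one]
    push_cast
    linear_combination h0
  -- `disc P = g(r)² · disc g`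
  have hd : P.d = -(P.a * r ^ 3 + P.b * r ^ 2 + P.c * r) := by linear_combination hr0
  have hfac : P.discr = (3 * P.a * r ^ 2 + 2 * P.b * r + P.c) ^ 2 *
      discrim P.a (P.b + P.a * r) (P.c + P.b * r + P.a * r ^ 2) := by
    rw [Cubic.discr, discrim, hd]
    ring
  rintro ⟨s, hs⟩
  -- `disc g` is a square
  have hsq : ∃ t, discrim P.a (P.b + P.a * r) (P.c + P.b * r + P.a * r ^ 2) = t * t := by
    set G := 3 * P.a * r ^ 2 + 2 * P.b * r + P.c with hG
    have h := hfac.symm.trans hs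
    refine ⟨s * G⁻¹, ?_⟩
    have hD : discrim P.a (P.b + P.a * r) (P.c + P.b * r + P.a * r ^ 2) = s * s / G ^ 2 := by
      rw [eq_div_iff (pow_ne_zero 2 hgr)]
      linear_combination h
    rw [hD, div_eq_mul_inv]
    ring
  obtain ⟨x, hx⟩ := exists_quadratic_eq_zero ha hsq
  -- `x` is a root of `P`, hence `x = r`, hence `g(r) = 0`: contradiction
  have hxroot : P.toPoly.IsRoot x := by
    rw [IsRoot.def]
    simp only [Cubic.toPoly, eval_add, eval_mul, eval_C, eval_pow, eval_X]
    rw [hd]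
    linear_combination (x - r) * hx
  have hxr : x = r := huniq x hxroot
  subst hxr
  apply hgr
  linear_combination hx

/-- **Stickelberger for cubics** (finite field of odd characteristic, `disc ≠ 0`): exactly one root iff the discriminant
is a non-square. [folklore] -/
theorem existsUnique_isRoot_iff_not_isSquare_discr [Fintype k] (h2 : ringChar k ≠ 2) (P : Cubic k) (ha : P.a ≠ 0)
    (hdisc0 : P.discr ≠ 0) : (∃! t : k, P.toPoly.IsRoot t) ↔ ¬ IsSquare P.discr := by
  haveI : NeZero (2 : k) := ⟨Ring.two_ne_zero h2⟩
  exact ⟨not_isSquare_discr_of_existsUnique_isRoot P ha hdisc0, existsUnique_isRoot_of_not_isSquare_discr h2 P ha⟩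

end Cubic

/-! ## §13. The `2`-division cubic of `W`: exactly one root mod `q` iff `(Δ_min / q) = −1` -/

section TwoDivision

open scoped Classical

open Polynomial WeierstrassCurve Literature.NumberTheory.EllipticCurves

/-- **Transposition primes in root-count currency.** For `W/ℚ` globally minimal and a prime `q ∤ 2Δ_min(W)`: the
`2`-division cubic `ψ = 4x³ + b₂x² + 2b₄x + b₆` of the minimal model has EXACTLY ONE root mod `q` iff `(Δ_min(W) / q) = −1`
(`disc ψ = 16Δ_min`; Stickelberger for cubics, `existsUnique_isRoot_iff_not_isSquare_discr`). Equivalently `#Ẽ(𝔽_q)[2] = 2`,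
`dim_{𝔽₂} E(ℚ_q)[2] = 1` — Frobenius at `q` is a transposition on `E[2] ∖ 0`. [cite: SilvermanAEC2009, III.1 (ψ₂, Δ)] -/
theorem existsUnique_zmod_root_twoTorsion_iff_jacobiSym_eq_neg_one (W : WeierstrassCurve ℚ) [W.IsGloballyMinimal]
    {q : ℕ} [hq : Fact q.Prime] (hq2 : q ≠ 2) (hqΔ : ¬ (q : ℤ) ∣ minimalDiscriminantInt W) :
    (∃! x : ZMod q, 4 * x ^ 3 + ((integralModelInt W).b₂ : ZMod q) * x ^ 2 + 2 * ((integralModelInt W).b₄ : ZMod q) * x +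
        ((integralModelInt W).b₆ : ZMod q) = 0) ↔ jacobiSym (minimalDiscriminantInt W) q = -1 := by
  set M : WeierstrassCurve (ZMod q) := (integralModelInt W).map (Int.castRingHom (ZMod q)) with hM
  have hchar : ringChar (ZMod q) ≠ 2 := by rw [ZMod.ringChar_zmod_n]; exact hq2
  have h2 : (2 : ZMod q) ≠ 0 := by
    have : ((2 : ℕ) : ZMod q) ≠ 0 := by
      rw [Ne, ZMod.natCast_eq_zero_iff]
      intro h
      exact hq2 ((Nat.prime_dvd_prime_iff_eq hq.out Nat.prime_two).mp h)
    exact_mod_cast this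
  have hΔM : M.Δ = ((minimalDiscriminantInt W : ℤ) : ZMod q) := by
    rw [hM, WeierstrassCurve.map_Δ, minimalDiscriminantInt, eq_intCast]
  have hΔ0 : M.Δ ≠ 0 := by
    rw [hΔM, Ne, ZMod.intCast_zmod_eq_zero_iff_dvd]
    exact hqΔ
  have h16 : (16 : ZMod q) ≠ 0 := by
    have : (16 : ZMod q) = 2 * 2 * 2 * 2 := by norm_num
    rw [this]
    exact mul_ne_zero (mul_ne_zero (mul_ne_zero h2 h2) h2) h2
  have hdisc0 : M.twoTorsionPolynomial.discr ≠ 0 := by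
    rw [WeierstrassCurve.twoTorsionPolynomial_discr]
    exact mul_ne_zero h16 hΔ0
  have ha : M.twoTorsionPolynomial.a ≠ 0 := by
    show (4 : ZMod q) ≠ 0
    have : (4 : ZMod q) = 2 * 2 := by norm_num
    rw [this]; exact mul_ne_zero h2 h2
  have hb₂ : M.b₂ = ((integralModelInt W).b₂ : ZMod q) := by rw [hM, WeierstrassCurve.map_b₂, eq_intCast]
  have hb₄ : M.b₄ = ((integralModelInt W).b₄ : ZMod q) := by rw [hM, WeierstrassCurve.map_b₄, eq_intCast]
  have hb₆ : M.b₆ = ((integralModelInt W).b₆ : ZMod q) := by rw [hM, WeierstrassCurve.map_b₆, eq_intCast]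
  have hψ : ∀ x : ZMod q, (4 * x ^ 3 + ((integralModelInt W).b₂ : ZMod q) * x ^ 2 +
      2 * ((integralModelInt W).b₄ : ZMod q) * x + ((integralModelInt W).b₆ : ZMod q) = 0) ↔
        M.twoTorsionPolynomial.toPoly.IsRoot x := fun x => by
    rw [IsRoot.def]
    simp only [WeierstrassCurve.twoTorsionPolynomial, Cubic.toPoly, eval_add, eval_mul, eval_C, eval_pow, eval_X,
      hb₂, hb₄, hb₆]
  rw [existsUnique_congr hψ, existsUnique_isRoot_iff_not_isSquare_discr hchar M.twoTorsionPolynomial ha hdisc0,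
    ZMod.nonsquare_iff_jacobiSym_eq_neg_one, WeierstrassCurve.twoTorsionPolynomial_discr, hΔM, not_iff_not]
  constructor
  · intro h16sq
    by_contra hu
    exact not_isSquare_sixteen_mul hu h2 h16sq
  · rintro ⟨r, hr⟩
    exact ⟨4 * r, by rw [hr]; ring⟩

/-! ## §14. Parity of the number of transposition primes of `d_K` -/

/-- A product of signs `±1` over a finset is `(−1)^{#{i : f i = −1}}`. [folklore] -/
theorem prod_eq_neg_one_pow_card_filter {ι : Type*} [DecidableEq ι] (s : Finset ι) (f : ι → ℤ)
    (hf : ∀ i ∈ s, f i = 1 ∨ f i = -1) :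
    ∏ i ∈ s, f i = (-1) ^ (s.filter fun i => f i = -1).card := by
  classical
  induction s using Finset.induction_on with
  | empty => simp
  | insert a s ha ih =>
    rw [Finset.prod_insert ha, Finset.filter_insert, ih fun i hi => hf i (Finset.mem_insert_of_mem hi)]
    rcases hf a (Finset.mem_insert_self a s) with h | h
    · rw [h, one_mul, if_neg (by decide)]
    · rw [h, if_pos rfl, Finset.card_insert_of_notMem (fun hm => ha (Finset.mem_filter.mp hm).1), pow_succ]
      ring

/-- **The number of transposition primes of `d_K` is odd iff `Δ_W < 0`.** `W/ℚ` globally minimal, `K` imaginary quadratic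
with ODD `d_K` satisfying the Heegner hypothesis for `N_W`; a prime `q ∣ d_K` is a transposition prime when the
`2`-division cubic `ψ` of the minimal model has exactly one root mod `q` (⟺ `(Δ_min / q) = −1`, §13; `q ∤ 2NΔ_min`
automatically). Since `|d_K|` is squarefree, `(Δ_min | |d_K|) = ∏_{q ∣ d_K} (Δ_min / q) = (−1)^{#transposition primes}`,
and this is `sign Δ_min` (`jacobiSym_minimalDiscriminantInt_natAbs_discr`). In the cell's notation:
`DEF(E,K) = Σ_{q∣d_K} dim Ẽ(𝔽_q)[2] + [Δ_E > 0] ≡ #transposition primes + [Δ_E > 0] ≡ 1 (mod 2)`.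
[cite: IrelandRosen1990, Prop. 5.2.2] [cite: SilvermanAEC2009, VIII.8] -/
theorem odd_card_transpositionPrimes_iff_Δ_neg (W : WeierstrassCurve ℚ) [W.IsElliptic] [W.IsGloballyMinimal]
    {K : Type} [Field K] [NumberField K] (hK : IsImaginaryQuadratic K) (hodd : Odd (discr K))
    (hH : SatisfiesHeegnerHypothesis (W.conductorNorm ℤ) K) :
    Odd (((discr K).natAbs.primeFactors.filter fun q => ∃! x : ZMod q,
        4 * x ^ 3 + ((integralModelInt W).b₂ : ZMod q) * x ^ 2 + 2 * ((integralModelInt W).b₄ : ZMod q) * x +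
          ((integralModelInt W).b₆ : ZMod q) = 0).card) ↔ W.Δ < 0 := by
  classical
  set m := (discr K).natAbs with hm
  have hm0 : m ≠ 0 := Int.natAbs_ne_zero.mpr (NumberField.discr_ne_zero K)
  have hsqf : Squarefree m := by
    rw [hm, Int.squarefree_natAbs]
    rcases Literature.NumberTheory.QuadraticFields.Quadratic.isFundamentalDiscriminant_discr (K := K) hK.1 with h | h
    · exact h.2.1
    · exfalso
      obtain ⟨e, he⟩ := h.1
      exact (Int.not_even_iff_odd.mpr hodd) ⟨2 * e, by rw [he]; ring⟩
  -- facts at each prime of `d_K`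
  have hq : ∀ q ∈ m.primeFactors, q.Prime ∧ q ≠ 2 ∧ ¬ (q : ℤ) ∣ minimalDiscriminantInt W := by
    intro q hqm
    have hqp : q.Prime := Nat.prime_of_mem_primeFactors hqm
    have hqd : (q : ℤ) ∣ discr K := Int.ofNat_dvd_left.mpr (Nat.dvd_of_mem_primeFactors hqm)
    have hq2 : q ≠ 2 := by
      rintro rfl
      exact (Int.not_even_iff_odd.mpr hodd) (even_iff_two_dvd.mpr (by exact_mod_cast hqd))
    refine ⟨hqp, hq2, fun hqΔ => ?_⟩
    exact Literature.SatisfiesHeegnerHypothesis.not_dvd_discr hK.1 hH hqp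
      (dvd_conductorNorm_of_dvd_minimalDiscriminantInt W hqp hqΔ) hqd
  -- `(Δ | m) = ∏_{q ∣ m} (Δ / q)`
  have hprod : jacobiSym (minimalDiscriminantInt W) m =
      ∏ q ∈ m.primeFactors, jacobiSym (minimalDiscriminantInt W) q := by
    have hf₀ : ∀ p ∈ m.primeFactorsList, p ≠ 0 := fun p hp => (Nat.pos_of_mem_primeFactorsList hp).ne'
    conv_lhs => rw [← Nat.prod_primeFactorsList hm0]
    rw [jacobiSym.list_prod_right hf₀, ← Nat.toFinset_factors,
      List.prod_toFinset _ ((Nat.squarefree_iff_nodup_primeFactorsList hm0).mp hsqf)]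
  -- each factor is `−1` exactly at the transposition primes, `+1` otherwise
  have hval : ∀ q ∈ m.primeFactors, jacobiSym (minimalDiscriminantInt W) q = 1 ∨
      jacobiSym (minimalDiscriminantInt W) q = -1 := by
    intro q hqm
    obtain ⟨hqp, -, hqΔ⟩ := hq q hqm
    refine jacobiSym.eq_one_or_neg_one ?_
    rw [Int.gcd_eq_natAbs, Int.natAbs_natCast]
    exact Nat.Coprime.symm ((Nat.Prime.coprime_iff_not_dvd hqp).mpr fun h => hqΔ (Int.ofNat_dvd_left.mpr h))
  have hfilter : (m.primeFactors.filter fun q => ∃! x : ZMod q,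
        4 * x ^ 3 + ((integralModelInt W).b₂ : ZMod q) * x ^ 2 + 2 * ((integralModelInt W).b₄ : ZMod q) * x +
          ((integralModelInt W).b₆ : ZMod q) = 0) =
      m.primeFactors.filter fun q => jacobiSym (minimalDiscriminantInt W) q = -1 := by
    refine Finset.filter_congr fun q hqm => ?_
    obtain ⟨hqp, hq2, hqΔ⟩ := hq q hqm
    haveI := Fact.mk hqp
    exact existsUnique_zmod_root_twoTorsion_iff_jacobiSym_eq_neg_one W hq2 hqΔ
  rw [hfilter, ← sign_minimalDiscriminantInt_eq_neg_one_iff W,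
    ← jacobiSym_minimalDiscriminantInt_natAbs_discr W hK hodd hH, ← hm, hprod,
    prod_eq_neg_one_pow_card_filter _ _ hval]
  rcases Nat.even_or_odd ((m.primeFactors.filter fun q => jacobiSym (minimalDiscriminantInt W) q = -1).card)
    with h | h
  · rw [h.neg_one_pow]
    exact ⟨fun h' => absurd h' (Nat.not_odd_iff_even.mpr h), fun h' => absurd h' (by decide)⟩
  · rw [h.neg_one_pow]
    exact ⟨fun _ => rfl, fun _ => h⟩

end TwoDivision

end Summit.BirchSwinnertonDyer.BirchSwinnertonDyer.Theorems.GenusKolyTwin
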